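import Mathlib.Topology.Sheaves.Flasque
import Mathlib.Topology.Sheaves.Abelian
import Mathlib.Topology.NoetherianSpace
import Mathlib.Topology.KrullDimension
import Mathlib.Topology.Sets.Closeds
import Mathlib.Order.KrullDimension
import Mathlib.CategoryTheory.Abelian.GrothendieckCategory.Subobject
import Mathlib.CategoryTheory.Subobject.MonoOver
import Mathlib.CategoryTheory.Limits.Shapes.Biproducts
import Mathlib.CategoryTheory.Sites.SheafCohomology.Basic
import Mathlib.CategoryTheory.Abelian.GrothendieckCategory.HasExt
import Mathlib.Algebra.Homology.DerivedCategory.Ext.ExactSequences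
import Mathlib.RingTheory.Int.Basic
import Literature.AlgebraicGeometry.Motives.GrothendieckVanishing
import Literature.AlgebraicGeometry.Motives.FlasqueCohomology
import Literature.AlgebraicGeometry.Motives.ConstantFlasque
import Literature.AlgebraicGeometry.Motives.DirectedColimits
import Literature.AlgebraicGeometry.Motives.SupportedSheaves
import Literature.AlgebraicGeometry.Motives.CohomologyColimits
import HarnessLib

/-!
# Grothendieck's vanishing theorem (Hartshorne III.2.7): proof

Topic: `Literature/AlgebraicGeometry/Motives` (discharges the named fact `Literature.AlgebraicGeometry.Motives.grothendieckVanishing` of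
`GrothendieckVanishing.lean`: on a noetherian topological space `X`, `Hⁱ(X, ℱ) = 0` for every sheaf
of abelian groups `ℱ` and every `i > dim X`; `Hⁱ` is Mathlib's `Sheaf.H`, `dim` is
`topologicalKrullDim`). Last link of the chain `FlasqueCohomology` (III.2.4, III.2.5),
`ConstantFlasque` (II Ex. 1.16(a)), `DirectedColimits` (II Ex. 1.11, III.2.8), `CohomologyColimits`
(III.2.9), `SupportedSheaves` (supports, `ℋ⁰_Y`, the sheaves `ℤ_{Y,U}`).

## The printed proof and the present formalization

Hartshorne (III.2.7, pp. 210–211) argues by induction on `n = dim X`: Step 1 reduces to `X`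
irreducible (dévissage `0 → ℱ_U → ℱ → ℱ_Y → 0` along an irreducible component `Y`, `U = X ∖ Y`, and
induction on the number of components, using III.2.10 to pass to closed subspaces); Step 2 treats
`dim X = 0`; Step 3 writes `ℱ = lim→ ℱ_α` over the finitely generated subsheaves `ℱ_α` (III.2.9) and, by
the sequences `0 → ℱ_{α'} → ℱ_α → 𝒢 → 0` and induction on the number of generators, reduces to quotients
of `ℤ_U`, i.e. (via `0 → ℛ → ℤ_U → ℱ → 0`) to subsheaves `ℛ ⊆ ℤ_U` and to `ℤ_U`; Step 4 treats
`ℛ ⊆ ℤ_U` (`d` = least positive local section, `ℤ_V ≅ d ℤ_V ⊆ ℛ` on a nonempty open `V`, quotient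
supported on `(U ∖ V)⁻` of smaller dimension); Step 5 treats `ℤ_U` via `0 → ℤ_U → ℤ → ℤ_Y → 0` with `ℤ`
flasque on the irreducible space `X` (II Ex. 1.16(a), III.2.5) and `dim Y < dim X`.

The formalization keeps the ambient noetherian space `X` fixed throughout and never passes to a
subspace: instead of a sheaf on a closed subset `Y ⊆ X` it works with a sheaf on `X` *supported on*
`Y` (`IsSupportedOn`, i.e. vanishing on the opens disjoint from `Y`), which is what III.2.10 /
Remark 2.10.1 ("we often write `ℱ` instead of `j_*ℱ`") amounts to, and the dimension of `Y` is
measured inside `X` (`sdim Y` = supremum of lengths of chains of irreducible closed subsets of `X`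
contained in `Y`; `sdim univ = topologicalKrullDim X`, `sdim_univ`). The statement proved by
noetherian induction on the closed subset `Y` (`GrothendieckVanishingProof.vanishingOn`, using
well-foundedness of `Closeds X`, Mathlib's `NoetherianSpace` API) is

  `VanishingOn Y`: for every abelian sheaf `G` on `X` supported on `Y` and every `i > sdim Y`,
  `Hⁱ(X, G) = 0`,

and the induction step splits as in the book:

* Step 1 (`vanishingOn_of_union`, `Y` reducible, `Y = Y₁ ∪ Y₂` with `Y₁, Y₂ ⊊ Y` closed): the
  dévissage `0 → ℋ⁰_{Y₁}(G) → G → 𝒬 → 0` with `ℋ⁰_{Y₁}(G) = supportedPart G Y₁` supported on `Y₁` and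
  `𝒬` supported on `Y₂`, and the long exact `Ext` sequence (`Ext.subsingleton_X₂`).
* Step 2 is absorbed: for `Y` irreducible, `sdim Y ≥ 0`, so only `i ≥ 1` occurs (`pos_of_sdim_lt`), and
  the arguments of Steps 3–5 work uniformly.
* Step 3 (`fg`, `single`, `isIso_colimit_desc`, `vanishingOn_of_isIrreducible`): generators are pairs
  `b = (U, s)` with `U ⊇ X ∖ Y` open and `s ∈ G(U)` (`GenIdx`; every section of `G` over any `V` extends
  to `V ∪ (X ∖ Y)` since `G` is supported on `Y`), the subsheaf generated by a finite set `α` of them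
  is the image of `⨁_{b ∈ α} ℤ_{Y,U_b} ⟶ G` (`fgSubsheaves`, a functor `Finset GenIdx ⥤ MonoOver G`),
  `G` is the filtered colimit of these (`isIso_colimit_desc`: mono by Mathlib's
  `IsGrothendieckAbelian.mono_of_isColimit_monoOver`, epi sectionwise), so III.2.9
  (`subsingleton_H_succ_of_isColimit`) reduces to finitely generated subsheaves, then induction on
  `α` (`fg`) to quotients of a single `ℤ_{Y,U}` (`single`), then to Steps 4 and 5.
* Step 4 (`step4`, subsheaves `ℛ ↪ ℤ_{Y,U}`): `d` = least positive value of a section of `ℛ`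
  (`rval`, `Nat.find`), attained by `ρ₀ ∈ ℛ(W₀)`; extend `ρ₀` to `U' = W₀ ∪ (X ∖ Y)` and map
  `ψ : ℤ_{Y,U'} ⟶ ℛ`, `1 ↦ ρ₀` (mono since `d ≠ 0`); every section of `ℛ` over an open `W ⊆ U'`
  meeting `Y` has value divisible by `d` (Bézout, `Int.gcd_eq_gcd_ab`, and minimality of `d`), so
  `coker ψ` is supported on `Y ∖ W₀ ⊊ Y` (induction hypothesis, `sdim` only drops) and Step 5 applies
  to `ℤ_{Y,U'}`.
* Step 5 (`step5`): `0 → ℤ_{Y,U} → ℤ_{Y,X} → 𝒬 → 0` with `ℤ_{Y,X}` flasque (`isFlasque_constSub_top`,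
  II Ex. 1.16(a)) hence acyclic (III.2.5, `subsingleton_H_of_isFlasque`), and `𝒬` supported on
  `Y ∖ U ⊊ Y`, of dimension `< sdim Y` when `Y` is irreducible (`sdim_lt_of_ssubset`).

Finally `grothendieckVanishing_holds` is `vanishingOn ⊤`. The file also records the discharges
`injective_isFlasque_holds` (III.2.4), `isFlasque_subsingleton_H_holds` (III.2.5) and
`isFlasque_constantSheaf_holds` (II Ex. 1.16(a)) of the other named facts of `GrothendieckVanishing.lean`
proved in `FlasqueCohomology.lean` and `ConstantFlasque.lean` (II Ex. 1.11 and III.2.8 are discharged in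
`DirectedColimits.lean`).

## References

* R. Hartshorne, *Algebraic Geometry*, GTM 52, Springer (1977), doi:10.1007/978-1-4757-3849-0,
  III.2, Thm. 2.7 (statement p. 208, proof pp. 210–211), with II Ex. 1.16, 1.19, 1.20 and III.2.4,
  2.5, 2.8, 2.9, 2.10. [Hartshorne1977]
* A. Grothendieck, *Sur quelques points d'algèbre homologique*, Tôhoku Math. J. 9 (1957), Thm. 3.6.5.
-/

open CategoryTheory Limits Opposite TopologicalSpace Order

universe u

namespace Literature.AlgebraicGeometry.Motives

/-! ### The dimension of a subset, measured by chains of irreducible closed subsets of the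
ambient space -/

section SubsetDimension

variable {X : Type u} [TopologicalSpace X]

/-- The (combinatorial) dimension of a subset `S ⊆ X`, measured inside `X`: the supremum of the
lengths of chains of irreducible closed subsets *of `X`* contained in `S`. Only
`sdim univ = topologicalKrullDim X` (`sdim_univ`), monotonicity (`sdim_mono`) and the dimension drop
on proper closed subsets of an irreducible closed set (`sdim_lt_of_ssubset`) are used below; for `S`
closed, `sdim S` agrees with the dimension of the subspace `S` (Hartshorne I.1, p. 5, and Ex. 1.10),
a comparison which is neither needed nor proved here. [folklore] -/
noncomputable def sdim (S : Set X) : WithBot ℕ∞ :=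
  krullDim {Z : IrreducibleCloseds X // (Z : Set X) ⊆ S}

/-- `sdim` is monotone in the subset. [folklore] -/
theorem sdim_mono {S T : Set X} (h : S ⊆ T) : sdim S ≤ sdim T :=
  krullDim_le_of_strictMono (fun Z : {Z : IrreducibleCloseds X // (Z : Set X) ⊆ S} =>
    (⟨Z.1, Z.2.trans h⟩ : {Z : IrreducibleCloseds X // (Z : Set X) ⊆ T})) fun _ _ hab => hab

/-- `sdim univ` is the (Krull) dimension of the topological space `X`. [folklore] -/
theorem sdim_univ : sdim (Set.univ : Set X) = topologicalKrullDim X :=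
  krullDim_eq_of_orderIso
    { toEquiv := Equiv.subtypeUnivEquiv fun _ => Set.subset_univ _
      map_rel_iff' := Iff.rfl }

/-- A (nonempty) irreducible closed subset has `0 ≤ sdim`. [folklore] -/
theorem sdim_nonneg_of_isIrreducible {Y : Set X} (hY : IsIrreducible Y) (hYc : IsClosed Y) :
    0 ≤ sdim Y := by
  haveI : Nonempty {Z : IrreducibleCloseds X // (Z : Set X) ⊆ Y} := ⟨⟨⟨Y, hY, hYc⟩, subset_rfl⟩⟩
  exact krullDim_nonneg

/-- **Dimension drops on proper closed subsets of an irreducible closed set**: if `Y` is an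
irreducible closed subset with `sdim Y < n + 1` and `Z ⊊ Y`, then `sdim Z < n` (a chain of
irreducible closed subsets inside `Z` extends by `Y` itself). (Hartshorne I.1.10(d) / proof of
III.2.7, "dim Y < dim X since X is irreducible".) [folklore] -/
theorem sdim_lt_of_ssubset {Y Z : Set X} (hY : IsIrreducible Y) (hYc : IsClosed Y) (hZY : Z ⊆ Y)
    (hne : Z ≠ Y) {n : ℕ} (hn : sdim Y < (n + 1 : ℕ)) : sdim Z < n := by
  rw [sdim, krullDim_lt_coe_iff] at hn ⊢
  intro l
  let y : {W : IrreducibleCloseds X // (W : Set X) ⊆ Y} := ⟨⟨Y, hY, hYc⟩, subset_rfl⟩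
  let f : {W : IrreducibleCloseds X // (W : Set X) ⊆ Z} →
      {W : IrreducibleCloseds X // (W : Set X) ⊆ Y} := fun W => ⟨W.1, W.2.trans hZY⟩
  have hf : StrictMono f := fun _ _ hab => hab
  have hlast : (l.map f hf).last < y := by
    rw [LTSeries.last_map]
    refine lt_of_le_of_ne (show ((l.last.1 : IrreducibleCloseds X) : Set X) ⊆ Y from
      l.last.2.trans hZY) fun h => hne (subset_antisymm hZY ?_)
    have h' : ((l.last.1 : IrreducibleCloseds X) : Set X) = Y :=
      congr_arg
        (fun W : {W : IrreducibleCloseds X // (W : Set X) ⊆ Y} =>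
          ((W.1 : IrreducibleCloseds X) : Set X)) h
    rw [← h']
    exact l.last.2
  have := hn ((l.map f hf).snoc y hlast)
  simp only [RelSeries.snoc_length, LTSeries.map_length] at this
  omega

end SubsetDimension


namespace GrothendieckVanishingProof

variable {X : TopCat.{u}}

/-- Finite biproducts in the abelian category of abelian sheaves (Mathlib's theorem
`Abelian.hasFiniteBiproducts`, registered here as a local instance for this category only).
[folklore] -/
theorem hasFiniteBiproducts_sheaf :
    HasFiniteBiproducts (Sheaf (Opens.grothendieckTopology X) AddCommGrpCat.{u}) :=
  Abelian.hasFiniteBiproducts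

attribute [local instance] hasFiniteBiproducts_sheaf

/-- The statement proved by noetherian induction on the closed subset `Y ⊆ X`: every abelian
sheaf on `X` supported on `Y` has `Hⁱ(X, G) = 0` for all `i > sdim Y`.
[cite: Hartshorne1977, III.2.7 (proof)] -/
def VanishingOn (Y : Set X) : Prop :=
  ∀ (G : Sheaf (Opens.grothendieckTopology X) AddCommGrpCat.{u}), IsSupportedOn G Y →
    ∀ (i : ℕ), sdim Y < i → Subsingleton (G.H i)

/-! #### Step 1: reduction to irreducible closed subsets -/

/-- The empty closed subset: sheaves supported on `∅` are zero. [folklore] -/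
theorem vanishingOn_empty : VanishingOn (∅ : Set X) := fun _G hG i _ =>
  Sheaf.subsingleton_H_of_isZero hG.isZero i

/-- **Step 1** of the proof of III.2.7 (dévissage along `0 → ℋ⁰_{Y₁}(G) → G → 𝒬 → 0`): if the
closed set `Y` is the union of the closed subsets `Y₁, Y₂` for which vanishing is known, then
vanishing holds for `Y`. [cite: Hartshorne1977, III.2.7 (proof, Step 1)] -/
theorem vanishingOn_of_union {Y Y₁ Y₂ : Set X} (hYc : IsClosed Y) (h1 : VanishingOn Y₁)
    (h2 : VanishingOn Y₂) (hY : Y ⊆ Y₁ ∪ Y₂) (hY₁ : Y₁ ⊆ Y) (hY₂ : Y₂ ⊆ Y) : VanishingOn Y := by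
  intro G hG i hi
  let ι := supportedPartι G Y₁
  let S := ShortComplex.cokernelSequence ι
  have hS : S.ShortExact :=
    { exact := ShortComplex.cokernelSequence_exact ι
      mono_f := inferInstanceAs (Mono ι) }
  -- the subsheaf of sections supported in `Y₁` is supported on `Y₁`
  have hA : IsSupportedOn (supportedPart G Y₁) Y₁ :=
    isSupportedOn_supportedPart G Y₁ hG hYc (Set.inter_subset_left)
  -- the quotient is supported on `Y₂`
  have hQ : IsSupportedOn S.X₃ Y₂ := by
    intro V hV s
    haveI : Epi S.g := hS.epi_g
    refine Sheaf.eq_zero_of_surjective S V (fun W hWV => ?_) s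
    refine surjective_supportedPartι_app_of_isSupportedOn G Y₁ hG hYc fun x ⟨hxW, hxY⟩ => ?_
    rcases hY hxY with h | h
    · exact h
    · exact absurd h (Set.disjoint_left.mp hV (hWV hxW))
  haveI : Subsingleton (S.X₁.H i) := h1 _ hA i (lt_of_le_of_lt (sdim_mono hY₁) hi)
  haveI : Subsingleton (S.X₃.H i) := h2 _ hQ i (lt_of_le_of_lt (sdim_mono hY₂) hi)
  exact Ext.subsingleton_X₂ _ hS i

/-! #### Values of sections of subsheaves of `ℤ_{Y,U}` -/

section RVal

variable {Y : Set X} {U : Opens X} {hY : IsPreirreducible Y} {hU : Yᶜ ⊆ (U : Set X)}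
  {R : Sheaf (Opens.grothendieckTopology X) AddCommGrpCat.{u}} (r : R ⟶ constSub hY hU)

/-- The value in `ℤ` of a section of a sheaf `ℛ` mapping to `ℤ_{Y,U}`. [folklore] -/
noncomputable def rval {W : Opens X} (ρ : R.obj.obj (op W)) : ℤ := (r.hom.app (op W) ρ).1.down

/-- `rval` is additive. [folklore] -/
theorem rval_add {W : Opens X} (ρ ρ' : R.obj.obj (op W)) :
    rval r (ρ + ρ') = rval r ρ + rval r ρ' := by
  simp only [rval, map_add]
  rfl

/-- `rval 0 = 0`. [folklore] -/
theorem rval_zero {W : Opens X} : rval r (0 : R.obj.obj (op W)) = 0 := by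
  simp only [rval, map_zero]
  rfl

/-- `rval (-ρ) = -rval ρ`. [folklore] -/
theorem rval_neg {W : Opens X} (ρ : R.obj.obj (op W)) : rval r (-ρ) = -rval r ρ := by
  simp only [rval, map_neg]
  rfl

/-- `rval (k • ρ) = k * rval ρ`. [folklore] -/
theorem rval_zsmul {W : Opens X} (k : ℤ) (ρ : R.obj.obj (op W)) :
    rval r (k • ρ) = k * rval r ρ := by
  simp only [rval, map_zsmul]
  exact constSubSections.coe_zsmul_down k _

/-- If `ℛ ⟶ ℤ_{Y,U}` is a monomorphism, sections of `ℛ` are determined by their values. [folklore] -/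
theorem rval_injective [Mono r] {W : Opens X} {ρ ρ' : R.obj.obj (op W)}
    (h : rval r ρ = rval r ρ') : ρ = ρ' :=
  Sheaf.injective_of_mono r _ (constSubSections.ext h)

/-- A section of `ℛ ⊆ ℤ_{Y,U}` with nonzero value lives over an open `W ⊆ U` meeting `Y`.
[folklore] -/
theorem le_and_nonempty_of_rval_ne_zero {W : Opens X} {ρ : R.obj.obj (op W)}
    (h : rval r ρ ≠ 0) : W ≤ U ∧ ((W : Set X) ∩ Y).Nonempty := by
  rcases (r.hom.app (op W) ρ).2 with h' | h'
  · exact h'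
  · exact absurd (by simp only [rval, h']; rfl) h

/-- Restricting to a smaller open still meeting `Y` does not change the value. [folklore] -/
theorem rval_map {W W' : Opens X} (i : W' ⟶ W) (hW' : ((W' : Set X) ∩ Y).Nonempty)
    (ρ : R.obj.obj (op W)) : rval r (R.obj.map i.op ρ) = rval r ρ := by
  simp only [rval]
  have e : r.hom.app (op W') (R.obj.map i.op ρ) =
      (constSub hY hU).obj.map i.op (r.hom.app (op W) ρ) :=
    NatTrans.naturality_apply r.hom i.op ρ
  rw [e]
  change (constSubRes Y U i.le (r.hom.app (op W) ρ)).1.down = _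
  rw [constSubRes_apply_coe_of_nonempty _ _ _ hW']

end RVal

/-! #### Steps 2–5: irreducible closed subsets -/

section Irreducible

variable {Y : Set X} (hY : IsIrreducible Y) (hYc : IsClosed Y)
  (IH : ∀ Z : Set X, IsClosed Z → Z ⊆ Y → Z ≠ Y → VanishingOn Z)

include hY hYc in
/-- If `sdim Y < i` for an irreducible closed `Y`, then `0 < i`. [folklore] -/
theorem pos_of_sdim_lt {i : ℕ} (hi : sdim Y < i) : 0 < i := by
  have h := lt_of_le_of_lt (sdim_nonneg_of_isIrreducible hY hYc) hi
  exact_mod_cast h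

include hY hYc IH

/-- **Step 5**: `Hⁱ(X, ℤ_{Y,U}) = 0` for `i > dim Y`, from `0 → ℤ_{Y,U} → ℤ_{Y,X} → ℤ_{Y,X}/ℤ_{Y,U} → 0`
with `ℤ_{Y,X}` flasque (II Ex. 1.16(a), III.2.5) and the quotient supported on `Y ∖ U`, of
smaller dimension (induction). [cite: Hartshorne1977, III.2.7 (proof, Step 5)] -/
theorem step5 (U : Opens X) (hU : Yᶜ ⊆ (U : Set X)) (i : ℕ) (hi : sdim Y < i) :
    Subsingleton ((constSub hY.isPreirreducible hU).H i) := by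
  by_cases hUY : (U : Set X) ∩ Y = ∅
  · exact Sheaf.subsingleton_H_of_isZero (isZero_constSub _ hU hUY) i
  obtain ⟨m, rfl⟩ := Nat.exists_eq_add_one_of_ne_zero (pos_of_sdim_lt hY hYc hi).ne'
  have hT : Yᶜ ⊆ ((⊤ : Opens X) : Set X) := fun _ _ => trivial
  let ι := constSubι hY.isPreirreducible hU hT le_top
  let S := ShortComplex.cokernelSequence ι
  have hS : S.ShortExact :=
    { exact := ShortComplex.cokernelSequence_exact ι
      mono_f := inferInstanceAs (Mono ι) }
  haveI : TopCat.Sheaf.IsFlasque S.X₂ := isFlasque_constSub_top hY.isPreirreducible hT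
  haveI : Subsingleton (S.X₂.H (m + 1)) := subsingleton_H_of_isFlasque _ _ (Nat.succ_pos m)
  -- the quotient is supported on the proper closed subset `Y ∖ U`
  have hQ : IsSupportedOn S.X₃ (Y ∩ (U : Set X)ᶜ) :=
    isSupportedOn_cokernel_constSubι hY.isPreirreducible hU hT le_top
  obtain ⟨x, hxU, hxY⟩ := Set.nonempty_iff_ne_empty.mpr hUY
  have hne : Y ∩ (U : Set X)ᶜ ≠ Y := fun h => ((h.symm ▸ hxY : x ∈ Y ∩ (U : Set X)ᶜ).2 hxU)
  have hdim : sdim (Y ∩ (U : Set X)ᶜ) < m :=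
    sdim_lt_of_ssubset hY hYc Set.inter_subset_left hne hi
  haveI : Subsingleton (S.X₃.H m) :=
    IH _ (hYc.inter U.2.isClosed_compl) Set.inter_subset_left hne _ hQ m hdim
  exact Ext.subsingleton_X₁ _ hS m

/-- **Step 4**: every subsheaf `ℛ ⊆ ℤ_{Y,U}` has `Hⁱ(X, ℛ) = 0` for `i > dim Y`: if `ℛ ≠ 0` and
`d` is the least positive integer occurring as a section of `ℛ`, then `d·ℤ_{Y,V} ≅ ℤ_{Y,V} ⊆ ℛ`
for a suitable open `V` meeting `Y`, with `ℛ/ℤ_{Y,V}` supported on `Y ∖ V` (induction), and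
Step 5 applies to `ℤ_{Y,V}`. [cite: Hartshorne1977, III.2.7 (proof, Step 4)] -/
theorem step4 (U : Opens X) (hU : Yᶜ ⊆ (U : Set X))
    (R : Sheaf (Opens.grothendieckTopology X) AddCommGrpCat.{u})
    (r : R ⟶ constSub hY.isPreirreducible hU) [Mono r] (i : ℕ) (hi : sdim Y < i) :
    Subsingleton (R.H i) := by
  classical
  have hY' := hY.isPreirreducible
  have hRY : IsSupportedOn R Y := (isSupportedOn_constSub hY' hU).of_mono r
  by_cases hR : ∀ (W : Opens X) (ρ : R.obj.obj (op W)), ρ = 0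
  · exact Sheaf.subsingleton_H_of_isZero (Sheaf.isZero_of_sections hR) i
  simp only [not_forall] at hR
  obtain ⟨W₁, ρ', hρ'⟩ := hR
  -- the least positive value `d` of a section of `ℛ`
  let P : ℕ → Prop := fun k => 0 < k ∧ ∃ (W : Opens X) (ρ : R.obj.obj (op W)), rval r ρ = k
  have hP : ∃ k, P k := by
    have hv : rval r ρ' ≠ 0 := fun h => hρ' (rval_injective r (h.trans (rval_zero r).symm))
    rcases lt_or_gt_of_ne hv with hlt | hgt
    · refine ⟨(rval r (-ρ')).toNat, ?_, W₁, -ρ', ?_⟩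
      · rw [rval_neg]
        omega
      · rw [Int.toNat_of_nonneg]
        rw [rval_neg]
        omega
    · exact ⟨(rval r ρ').toNat, by omega, W₁, ρ', (Int.toNat_of_nonneg hgt.le).symm⟩
  obtain ⟨hd0, W₀, ρ₀, hρ₀⟩ := Nat.find_spec hP
  have hdmin : ∀ k, P k → Nat.find hP ≤ k := fun k hk => Nat.find_min' hP hk
  set d := Nat.find hP with hd
  have hd0' : (d : ℤ) ≠ 0 := by exact_mod_cast hd0.ne'
  obtain ⟨hW₀U, hW₀Y⟩ := le_and_nonempty_of_rval_ne_zero r (ρ := ρ₀) (by rw [hρ₀]; exact hd0')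
  -- extend `ρ₀` to `U' = W₀ ∪ (X ∖ Y)`
  let U' : Opens X := W₀ ⊔ (⟨Y, hYc⟩ : Closeds X).compl
  have hU' : Yᶜ ⊆ (U' : Set X) := fun x hx => Or.inr hx
  obtain ⟨ρ₁, hρ₁⟩ := hRY.surjective_map_of_isClosed hYc W₀ ρ₀
  have hρ₁v : rval r ρ₁ = d := by rw [← rval_map r (homOfLE le_sup_left) hW₀Y ρ₁, hρ₁, hρ₀]
  -- the morphism `ψ : ℤ_{Y,U'} ⟶ ℛ` defined by `ρ₁`, and the values of its sections
  let ψ := constSubDesc hY' hU' hRY ρ₁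
  have hψ : ∀ (V : Opens X) (n : (constSub hY' hU').obj.obj (op V)),
      rval r (ψ.hom.app (op V) n) = d * n.1.down := by
    intro V n
    by_cases hV : V ≤ U'
    · rw [constSubDesc_app_apply hY' hU' hRY ρ₁ hV, rval_zsmul]
      by_cases hVY : ((V : Set X) ∩ Y).Nonempty
      · rw [rval_map r _ hVY, hρ₁v, mul_comm]
      · rw [constSubSections.eq_zero_of_not_nonempty n hVY]
        simp
    · rw [constSubDesc_app_apply_of_not_le hY' hU' hRY ρ₁ hV, rval_zero,
        constSubSections.eq_zero_of_not_le n hV]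
      simp
  haveI : Mono ψ := Sheaf.mono_of_injective ψ fun V n m hnm => by
    have h := congr_arg (rval r) hnm
    rw [hψ, hψ] at h
    exact constSubSections.ext (mul_left_cancel₀ hd0' h)
  -- the cokernel of `ψ` is supported on `Y ∖ W₀`
  let S := ShortComplex.cokernelSequence ψ
  have hS : S.ShortExact :=
    { exact := ShortComplex.cokernelSequence_exact ψ
      mono_f := inferInstanceAs (Mono ψ) }
  have hQ : IsSupportedOn S.X₃ (Y ∩ (W₀ : Set X)ᶜ) := by
    intro V hV s
    haveI : Epi S.g := hS.epi_g
    refine Sheaf.eq_zero_of_surjective S V (fun W hWV (ρ : R.obj.obj (op W)) => ?_) s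
    by_cases hWY : ((W : Set X) ∩ Y).Nonempty
    · have hWU' : W ≤ U' := fun x hx => by
        by_cases hxY : x ∈ Y
        · left
          by_contra hxW₀
          exact Set.disjoint_left.mp hV (hWV hx) ⟨hxY, hxW₀⟩
        · exact Or.inr hxY
      -- `d` divides the value `v` of `ρ` (Bézout and minimality of `d`)
      set v := rval r ρ with hv
      let one := constSubOne (Y := Y) hWU' hWY
      have hone : rval r (ψ.hom.app (op W) one) = d := by
        rw [hψ, constSubOne_coe_down, mul_one]
      have hdvd : (d : ℤ) ∣ v := by
        let σ : R.obj.obj (op W) := Int.gcdA d v • ψ.hom.app (op W) one + Int.gcdB d v • ρ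
        have hσ : rval r σ = Int.gcd d v := by
          change rval r (Int.gcdA d v • ψ.hom.app (op W) one + Int.gcdB d v • ρ) = _
          rw [Int.gcd_eq_gcd_ab d v, rval_add, rval_zsmul, rval_zsmul, hone]
          ring
        have hg0 : 0 < Int.gcd d v := Int.gcd_pos_of_ne_zero_left v hd0'
        have hle : d ≤ Int.gcd d v := hdmin _ ⟨hg0, W, σ, hσ⟩
        have hge : Int.gcd d v ≤ d :=
          Nat.le_of_dvd hd0 (Int.natCast_dvd_natCast.mp (Int.gcd_dvd_left d v))
        have hgd : Int.gcd d v = d := le_antisymm hge hle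
        exact hgd ▸ Int.gcd_dvd_right d v
      obtain ⟨k, hk⟩ := hdvd
      refine ⟨k • one, rval_injective r ?_⟩
      change rval r (ψ.hom.app (op W) (k • one)) = v
      rw [hψ, constSubSections.coe_zsmul_down, constSubOne_coe_down, mul_one, hk]
    · rw [hRY W (Set.disjoint_iff_inter_eq_empty.mpr (Set.not_nonempty_iff_eq_empty.mp hWY)) ρ]
      exact ⟨0, map_zero _⟩
  -- conclusion
  obtain ⟨x, hxW₀, hxY⟩ := hW₀Y
  have hne : Y ∩ (W₀ : Set X)ᶜ ≠ Y := fun h => ((h.symm ▸ hxY : x ∈ Y ∩ (W₀ : Set X)ᶜ).2 hxW₀)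
  haveI : Subsingleton (S.X₁.H i) := step5 hY hYc IH U' hU' i hi
  haveI : Subsingleton (S.X₃.H i) := IH _ (hYc.inter W₀.2.isClosed_compl) Set.inter_subset_left
    hne _ hQ i (lt_of_le_of_lt (sdim_mono Set.inter_subset_left) hi)
  exact Ext.subsingleton_X₂ _ hS i

/-- **Step 3** (one generator): a quotient `𝒬` of `ℤ_{Y,U}` has `Hⁱ(X, 𝒬) = 0` for `i > dim Y`
(long exact sequence of `0 → ℛ → ℤ_{Y,U} → 𝒬 → 0`, Steps 4 and 5).
[cite: Hartshorne1977, III.2.7 (proof, Step 3)] -/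
theorem single (U : Opens X) (hU : Yᶜ ⊆ (U : Set X))
    (Q : Sheaf (Opens.grothendieckTopology X) AddCommGrpCat.{u})
    (π : constSub hY.isPreirreducible hU ⟶ Q) [Epi π] (i : ℕ) (hi : sdim Y < i) :
    Subsingleton (Q.H i) := by
  let S := ShortComplex.kernelSequence π
  have hS : S.ShortExact :=
    { exact := ShortComplex.kernelSequence_exact π
      epi_g := inferInstanceAs (Epi π) }
  haveI : Subsingleton (S.X₂.H i) := step5 hY hYc IH U hU i hi
  haveI : Subsingleton (S.X₁.H (i + 1)) :=
    step4 hY hYc IH U hU _ (kernel.ι π) (i + 1) (hi.trans (by exact_mod_cast Nat.lt_succ_self i))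
  exact Ext.subsingleton_X₃ _ hS i

end Irreducible

/-! #### Step 3: finitely generated subsheaves and the passage to the limit -/

section Generators

variable {Y : Set X} (hY : IsPreirreducible Y)
  (G : Sheaf (Opens.grothendieckTopology X) AddCommGrpCat.{u}) (hG : IsSupportedOn G Y)

/-- The index set of generators: sections of `G` over opens containing `X ∖ Y`. [folklore] -/
def GenIdx : Type u := Σ (U : {U : Opens X // Yᶜ ⊆ (U : Set X)}), G.obj.obj (op U.1)

variable {G} in
/-- The sheaf `ℤ_{Y,U}` attached to a generator `(U, s)`. [folklore] -/
noncomputable abbrev gen (b : GenIdx (Y := Y) G) :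
    Sheaf (Opens.grothendieckTopology X) AddCommGrpCat.{u} :=
  constSub hY b.1.2

variable {G} in
/-- The morphism `ℤ_{Y,U} ⟶ G`, `1 ↦ s`, attached to a generator `(U, s)`. [folklore] -/
noncomputable abbrev genMap (b : GenIdx (Y := Y) G) : gen hY b ⟶ G :=
  constSubDesc hY b.1.2 hG b.2

/-- The finite direct sums `⨁_{b ∈ α} ℤ_{Y,U_b}`. [folklore] -/
noncomputable abbrev genSum (α : Finset (GenIdx (Y := Y) G)) :
    Sheaf (Opens.grothendieckTopology X) AddCommGrpCat.{u} :=
  ⨁ fun b : α => gen hY b.1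

/-- The morphism `⨁_{b ∈ α} ℤ_{Y,U_b} ⟶ G` defined by the sections `s_b`; its image is the
subsheaf of `G` generated by the sections `s_b`, `b ∈ α`. [folklore] -/
noncomputable abbrev genSumDesc (α : Finset (GenIdx (Y := Y) G)) : genSum hY G α ⟶ G :=
  biproduct.desc fun b => genMap hY hG b.1

/-- The inclusion of direct sums `⨁_{b ∈ α} ⟶ ⨁_{b ∈ β}` for `α ⊆ β`. [folklore] -/
noncomputable abbrev genSumMap {α β : Finset (GenIdx (Y := Y) G)} (h : α ⊆ β) :
    genSum hY G α ⟶ genSum hY G β :=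
  biproduct.desc fun b => biproduct.ι (fun b' : β => gen hY b'.1) ⟨b.1, h b.2⟩

/-- The inclusions of direct sums are compatible with the maps to `G`. [folklore] -/
theorem genSumMap_desc {α β : Finset (GenIdx (Y := Y) G)} (h : α ⊆ β) :
    genSumMap hY G h ≫ genSumDesc hY G hG β = genSumDesc hY G hG α := by
  apply biproduct.hom_ext'
  intro b
  simp

/-- The functor `α ↦ (image of ⨁_{b ∈ α} ℤ_{Y,U_b} ⟶ G)` of finitely generated subsheaves of `G`,
as subobjects of `G`. [folklore] -/
noncomputable def fgSubsheaves : Finset (GenIdx (Y := Y) G) ⥤ MonoOver G where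
  obj α := MonoOver.mk (image.ι (genSumDesc hY G hG α))
  map {α β} h := MonoOver.homMk
    (image.lift
      { I := image (genSumDesc hY G hG β)
        m := image.ι _
        e := genSumMap hY G h.le ≫ factorThruImage _
        fac := by rw [Category.assoc, image.fac, genSumMap_desc] })
    (image.lift_fac _)
  map_id _ := Subsingleton.elim _ _
  map_comp _ _ := Subsingleton.elim _ _

/-- `G` is the filtered colimit (union) of its finitely generated subsheaves: the canonical
morphism from the colimit of the images of the `⨁_{b ∈ α} ℤ_{Y,U_b} ⟶ G` to `G` is an
isomorphism (a monomorphism by AB5, and onto because every section of `G` over `V` extends to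
`V ∪ (X ∖ Y)` and is then the image of `1 ∈ ℤ_{Y, V ∪ (X ∖ Y)}`).
[cite: Hartshorne1977, III.2.7 (proof, Step 3)] -/
theorem isIso_colimit_desc (hYc : IsClosed Y)
    (c : Cocone (fgSubsheaves hY G hG ⋙ MonoOver.forget G ⋙ Over.forget G)) (hc : IsColimit c)
    (f : c.pt ⟶ G) (hf : ∀ α, c.ι.app α ≫ f = ((fgSubsheaves hY G hG).obj α).obj.hom) :
    IsIso f := by
  classical
  haveI : Mono f := IsGrothendieckAbelian.mono_of_isColimit_monoOver _ hc f hf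
  refine Sheaf.isIso_of_bijective f fun V => ⟨Sheaf.injective_of_mono f V, fun t => ?_⟩
  obtain ⟨V⟩ := V
  -- extend `t` to `V' = V ∪ (X ∖ Y)`
  let V' : Opens X := V ⊔ (⟨Y, hYc⟩ : Closeds X).compl
  have hV' : Yᶜ ⊆ (V' : Set X) := fun x hx => Or.inr hx
  obtain ⟨t', rfl⟩ := hG.surjective_map_of_isClosed hYc V t
  suffices h : ∃ y, f.hom.app (op V') y = t' by
    obtain ⟨y, rfl⟩ := h
    exact ⟨c.pt.obj.map (homOfLE le_sup_left).op y, NatTrans.naturality_apply f.hom _ y⟩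
  by_cases hV'Y : ((V' : Set X) ∩ Y).Nonempty
  · let b : GenIdx (Y := Y) G := ⟨⟨V', hV'⟩, t'⟩
    let α : Finset (GenIdx (Y := Y) G) := {b}
    let e := (biproduct.ι (fun b' : α => gen hY b'.1) ⟨b, Finset.mem_singleton_self b⟩).hom.app
      (op V') (constSubOne le_rfl hV'Y)
    let ια : image (genSumDesc hY G hG α) ⟶ c.pt := c.ι.app α
    have hια : ια ≫ f = image.ι (genSumDesc hY G hG α) := hf α
    refine ⟨ια.hom.app (op V') ((factorThruImage (genSumDesc hY G hG α)).hom.app (op V') e), ?_⟩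
    rw [← Sheaf.comp_hom_app_apply (factorThruImage (genSumDesc hY G hG α)) ια,
      ← Sheaf.comp_hom_app_apply _ f, Category.assoc, hια, image.fac]
    change (biproduct.ι (fun b' : α => gen hY b'.1) ⟨b, Finset.mem_singleton_self b⟩ ≫
      biproduct.desc fun b' : α => genMap hY hG b'.1).hom.app (op V') (constSubOne le_rfl hV'Y) = t'
    rw [biproduct.ι_desc]
    exact constSubDesc_app_one hY hV' hG t' hV'Y
  · refine ⟨0, ?_⟩
    rw [map_zero]
    exact (hG V' (Set.disjoint_iff_inter_eq_empty.mpr (Set.not_nonempty_iff_eq_empty.mp hV'Y))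
      t').symm

/-- The diagram `α ↦ im(⨁_{b ∈ α} ℤ_{Y,U_b} ⟶ G)` of finitely generated subsheaves of `G`, as a
diagram of sheaves. [folklore] -/
noncomputable def fgDiagram :
    Finset (GenIdx (Y := Y) G) ⥤ Sheaf (Opens.grothendieckTopology X) AddCommGrpCat.{u} :=
  fgSubsheaves hY G hG ⋙ MonoOver.forget G ⋙ Over.forget G

/-- The cocone of inclusions of the finitely generated subsheaves into `G`. [folklore] -/
noncomputable def fgCocone : Cocone (fgDiagram hY G hG) where
  pt := G
  ι := { app := fun α => ((fgSubsheaves hY G hG).obj α).obj.hom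
         naturality := fun α β h => by
           change ((fgSubsheaves hY G hG).map h).hom.left ≫ ((fgSubsheaves hY G hG).obj β).obj.hom =
             ((fgSubsheaves hY G hG).obj α).obj.hom ≫ 𝟙 G
           rw [Category.comp_id]
           exact MonoOver.w ((fgSubsheaves hY G hG).map h) }

end Generators

section FG

variable {Y : Set X} (hY : IsIrreducible Y) (hYc : IsClosed Y)
  (IH : ∀ Z : Set X, IsClosed Z → Z ⊆ Y → Z ≠ Y → VanishingOn Z)

include hY hYc IH

/-- **Step 3** (finitely many generators): a sheaf `𝒬` supported on `Y` which is a quotient of a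
finite direct sum `⨁_{b ∈ α} ℤ_{Y,U_b}` ("generated by finitely many sections") has
`Hⁱ(X, 𝒬) = 0` for `i > dim Y`; by induction on the number of generators, using the exact
sequences `0 → 𝒬' → 𝒬 → 𝒬/𝒬' → 0` with `𝒬'` generated by fewer sections and `𝒬/𝒬'` by one.
[cite: Hartshorne1977, III.2.7 (proof, Step 3)] -/
theorem fg (G : Sheaf (Opens.grothendieckTopology X) AddCommGrpCat.{u})
    (α : Finset (GenIdx (Y := Y) G))
    (Q : Sheaf (Opens.grothendieckTopology X) AddCommGrpCat.{u})
    (π : genSum hY.isPreirreducible G α ⟶ Q) [Epi π] (hQ : IsSupportedOn Q Y) (i : ℕ)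
    (hi : sdim Y < i) : Subsingleton (Q.H i) := by
  classical
  induction α using Finset.induction_on generalizing Q with
  | empty =>
    have h0 : IsZero (genSum hY.isPreirreducible G (∅ : Finset (GenIdx (Y := Y) G))) := by
      rw [IsZero.iff_id_eq_zero]
      apply biproduct.hom_ext'
      intro b
      exact absurd b.2 (Finset.notMem_empty _)
    exact Sheaf.subsingleton_H_of_isZero (h0.of_epi π) i
  | insert b α hb ih =>
    have hY' := hY.isPreirreducible
    let j₁ := genSumMap hY' G (Finset.subset_insert b α)
    -- the subsheaf generated by the sections in `α`
    let Q' := image (j₁ ≫ π)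
    have hQ' : IsSupportedOn Q' Y := hQ.of_mono (image.ι (j₁ ≫ π))
    let S := ShortComplex.cokernelSequence (image.ι (j₁ ≫ π))
    have hS : S.ShortExact :=
      { exact := ShortComplex.cokernelSequence_exact _
        mono_f := inferInstanceAs (Mono (image.ι (j₁ ≫ π))) }
    haveI : Subsingleton (S.X₁.H i) := ih Q' (factorThruImage (j₁ ≫ π)) hQ'
    -- the quotient is generated by the single section `b`
    let p : Q ⟶ cokernel (image.ι (j₁ ≫ π)) := cokernel.π _
    let ιb := biproduct.ι (fun b' : (insert b α : Finset _) => gen hY' b'.1)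
      ⟨b, Finset.mem_insert_self b α⟩
    let ψ : gen hY' b ⟶ cokernel (image.ι (j₁ ≫ π)) := ιb ≫ π ≫ p
    haveI : Epi p := coequalizer.π_epi
    haveI : Epi (π ≫ p) := epi_comp _ _
    have hzero : j₁ ≫ π ≫ p = 0 := by
      have e := congrArg (fun q => q ≫ p) (image.fac (j₁ ≫ π))
      simp only [Category.assoc] at e
      rw [← e]
      simp [p]
    have hfac : biproduct.π (fun b' : (insert b α : Finset _) => gen hY' b'.1)
        ⟨b, Finset.mem_insert_self b α⟩ ≫ ψ = π ≫ p := by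
      apply biproduct.hom_ext'
      rintro ⟨b', hb'⟩
      by_cases hbb' : b' = b
      · subst hbb'
        simp only [ψ, ιb, biproduct.ι_π_self_assoc]
      · rw [biproduct.ι_π_ne_assoc _ (fun h => hbb' (congr_arg Subtype.val h)), zero_comp]
        have hb'α : b' ∈ α := (Finset.mem_insert.mp hb').resolve_left hbb'
        have e : biproduct.ι (fun b' : (insert b α : Finset _) => gen hY' b'.1) ⟨b', hb'⟩ =
            biproduct.ι (fun b' : (α : Finset _) => gen hY' b'.1) ⟨b', hb'α⟩ ≫ j₁ := by
          simp [j₁]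
        rw [e, Category.assoc, hzero, comp_zero]
    haveI : Epi ψ := epi_of_epi_fac hfac
    have hQ'' : IsSupportedOn (cokernel (image.ι (j₁ ≫ π))) Y := hQ.of_epi p
    haveI : Subsingleton (S.X₃.H i) := single hY hYc IH b.1.1 b.1.2 _ ψ i hi
    exact Ext.subsingleton_X₂ _ hS i

/-- **Steps 2–5 assembled**: vanishing for sheaves supported on an irreducible closed subset `Y`,
given vanishing for all proper closed subsets of `Y`: `G` is the direct limit of its finitely
generated subsheaves (III.2.9 and the previous steps). [cite: Hartshorne1977, III.2.7 (proof)] -/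
theorem vanishingOn_of_isIrreducible [NoetherianSpace X] : VanishingOn Y := by
  intro G hG i hi
  have hY' := hY.isPreirreducible
  obtain ⟨m, rfl⟩ := Nat.exists_eq_add_one_of_ne_zero (pos_of_sdim_lt hY hYc hi).ne'
  haveI : HasColimit (fgDiagram hY' G hG) := inferInstance
  let f : colimit (fgDiagram hY' G hG) ⟶ G := colimit.desc _ (fgCocone hY' G hG)
  have hf : ∀ α, colimit.ι (fgDiagram hY' G hG) α ≫ f = ((fgSubsheaves hY' G hG).obj α).obj.hom :=
    fun α => colimit.ι_desc _ α
  haveI : IsIso f :=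
    isIso_colimit_desc hY' G hG hYc _ (colimit.isColimit (fgDiagram hY' G hG)) f hf
  haveI : Subsingleton ((colimit (fgDiagram hY' G hG)).H (m + 1)) :=
    subsingleton_H_succ_of_isColimit (fgDiagram hY' G hG)
      (colimit.isColimit (fgDiagram hY' G hG)) m fun α =>
      fg hY hYc IH G α (image (genSumDesc hY' G hG α)) (factorThruImage _)
        (hG.of_mono (image.ι _)) (m + 1) hi
  refine subsingleton_of_forall_eq 0 fun x => ?_
  have hx : x = Sheaf.H.map f (m + 1) (Sheaf.H.map (inv f) (m + 1) x) := by
    rw [← Sheaf.H.map_comp_apply, IsIso.inv_hom_id, Sheaf.H.map_id_apply]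
  rw [hx, Subsingleton.elim (Sheaf.H.map (inv f) (m + 1) x) 0, map_zero]

end FG

/-! #### The induction -/

/-- Grothendieck vanishing for sheaves supported on a closed subset `Y` of a noetherian space, by
noetherian induction on `Y`. [cite: Hartshorne1977, III.2.7 (proof)] -/
theorem vanishingOn [NoetherianSpace X] (Y : Closeds X) : VanishingOn (Y : Set X) := by
  induction Y using WellFoundedLT.induction with
  | _ Y IHY =>
  have IH : ∀ Z : Set X, IsClosed Z → Z ⊆ Y → Z ≠ Y → VanishingOn Z := fun Z hZ hZY hne =>
    IHY ⟨Z, hZ⟩ (lt_of_le_of_ne hZY fun h => hne (congr_arg SetLike.coe h))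
  by_cases hYe : (Y : Set X) = ∅
  · rw [hYe]
    exact vanishingOn_empty
  by_cases hYi : IsPreirreducible (Y : Set X)
  · exact vanishingOn_of_isIrreducible ⟨Set.nonempty_iff_ne_empty.mpr hYe, hYi⟩ Y.2 IH
  -- `Y` reducible: `Y = (Y ∖ u) ∪ (Y ∖ v)` for opens `u`, `v` meeting `Y` with `Y ∩ u ∩ v = ∅`
  simp only [IsPreirreducible, not_forall, exists_prop] at hYi
  obtain ⟨u, v, hu, hv, ⟨y₁, hy₁⟩, ⟨y₂, hy₂⟩, huv⟩ := hYi
  rw [Set.not_nonempty_iff_eq_empty] at huv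
  refine vanishingOn_of_union (Y₁ := (Y : Set X) ∩ uᶜ) (Y₂ := (Y : Set X) ∩ vᶜ) Y.2
    (IH _ (Y.2.inter hu.isClosed_compl) Set.inter_subset_left fun h => ?_)
    (IH _ (Y.2.inter hv.isClosed_compl) Set.inter_subset_left fun h => ?_)
    (fun y hy => ?_) Set.inter_subset_left Set.inter_subset_left
  · exact ((h.symm ▸ hy₁.1 : y₁ ∈ (Y : Set X) ∩ uᶜ).2 hy₁.2)
  · exact ((h.symm ▸ hy₂.1 : y₂ ∈ (Y : Set X) ∩ vᶜ).2 hy₂.2)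
  · by_cases hyu : y ∈ u
    · refine Or.inr ⟨hy, fun hyv => ?_⟩
      have : y ∈ (Y : Set X) ∩ (u ∩ v) := ⟨hy, hyu, hyv⟩
      rw [huv] at this
      exact this
    · exact Or.inl ⟨hy, hyu⟩

end GrothendieckVanishingProof

/-! ### Discharges of the named facts of `GrothendieckVanishing.lean` -/

/-- Discharge of the named fact `injective_isFlasque` (**Hartshorne III.2.4**: injective abelian
sheaves are flasque), from `FlasqueCohomology.lean`. [cite: Hartshorne1977, III.2.4] -/
theorem injective_isFlasque_holds : injective_isFlasque.{u} := fun _ I hI =>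
  isFlasque_of_injective' I hI

/-- Discharge of the named fact `isFlasque_subsingleton_H` (**Hartshorne III.2.5**: flasque abelian
sheaves have `Hⁱ = 0` for `i > 0`), from `FlasqueCohomology.lean`. [cite: Hartshorne1977, III.2.5] -/
theorem isFlasque_subsingleton_H_holds : isFlasque_subsingleton_H.{u} := fun _ F _ i hi =>
  subsingleton_H_of_isFlasque' F i hi

/-- Discharge of the named fact `isFlasque_constantSheaf` (**Hartshorne II, Ex. 1.16(a)**: constant
sheaves on irreducible spaces are flasque), from `ConstantFlasque.lean`.
[cite: Hartshorne1977, II Ex. 1.16(a)] -/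
theorem isFlasque_constantSheaf_holds : isFlasque_constantSheaf.{u} := fun _ _ A =>
  isFlasque_constantSheaf' A

/-- **Grothendieck's vanishing theorem** (Hartshorne III.2.7), in the form of the named fact
`Literature.AlgebraicGeometry.Motives.grothendieckVanishing` of `GrothendieckVanishing.lean`: on a noetherian topological space
`X`, `Hⁱ(X, ℱ) = 0` for every sheaf of abelian groups `ℱ` and every `i > dim X`.
[cite: Hartshorne1977, III.2.7] -/
theorem grothendieckVanishing_holds : grothendieckVanishing.{u} := by
  intro X _ F i hi
  have h := GrothendieckVanishingProof.vanishingOn (X := X) ⊤ F (isSupportedOn_univ F) i (by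
    rw [Closeds.coe_top, sdim_univ]
    exact hi)
  exact h

end Literature.AlgebraicGeometry.Motives
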